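import Summits.CriticalPhenomena.CardyFormulaZ2.Theorems.CardyGluingRDEBoxMergingRefinement
import Summits.CriticalPhenomena.CardyFormulaZ2.Theorems.CardyGluingRDEBoxMerging

/-!
# `CardyGluingRDE.BoxMerging`: `TV_j` is monotone in `j`, and `BoxMerging` is the entry clause of
# the thesis (stmt-CriticalPhenomena-8582 / stmt-CriticalPhenomena-8580)

Route `CardyGluingRDE` (sub-problem `CardyFormulaZ2`), item `BoxMerging`
(stmt-CriticalPhenomena-8582): `TV_j(u,u')` is half the `ℓ¹` distance between the bond-`ℤ²`
(mesh `u`) and site-`𝕋` (mesh `u'`) laws of the resolution-`j` segment-connectivity matrix of the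
square `(0, δ₀)²`; the item asks `TV_j(u,u') → 0` as `u, u' → 0⁺` for every `j`.  The crux
`GluingContraction` (stmt-CriticalPhenomena-8580, the thesis X) sums the `TV_j` into
`Dw_K = Σ_{j ≤ K} 2^(−σj) TV_j` and asserts (A) LOCAL CONTRACTION of `Dw_K` under mesh-halving
from the lattice-resolution onset and (B) ENTRY: some `ℤ²`-mesh `u_Z ≤ δ₀/(C·2^K)` with
`Dw_K ≤ ρ/2` on the window `[u_Z/2^m, u_Z] × (0, δ_T]`.

Using the refinement bookkeeping of `CardyGluingRDEBoxMergingRefinement.lean` (the level-`j`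
crossing events are unions of level-`(j+1)` crossing events between children, so the level-`j`
cells are unions of level-`(j+1)` cells over the fibres of one coarse-graining map, the same on
both lattices) this file proves:

* `BoxMerging_tv_succ_le` — **`TV_j ≤ TV_{j+1}`** for every `δ₀ > 0`, every `ℤ²`-mesh `u` and
  every `𝕋`-mesh `u' > 0` (total variation contracts under push-forward), route `TV` verbatim;
* `BoxMerging_tv_mono` — `TV_j ≤ TV_k` for `j ≤ k`;
* `BoxMerging_iff_frequently` — `BoxMerging` is equivalent to merging at arbitrarily fine
  resolutions only (for every `j` some `k ≥ j` merges);
* `BoxMerging_entry` — **`BoxMerging` implies clause (B) of `GluingContraction`** for ALL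
  parameters `σ ≥ 0`, `C, ρ > 0`, `m`, `δ₀ > 0`, `K` (one application of `BoxMerging` at the top
  resolution `K`, `TV_j ≤ TV_K`, and `2^(−σj) ≤ 1`, so `Dw_K ≤ (K+1)·TV_K`) — the route-review
  refuter's remark on stmt-8580 ("clause (B) has no lower bound on `u_Z`, so it is of
  `BoxMerging` strength") as a theorem;
* `BoxMerging_gluingContraction_iff` — **`GluingContraction ↔ (clause (A) alone) ∧ BoxMerging`**
  (`→`: `BoxMerging_of_GluingContraction`, tree; `←`: `BoxMerging_entry` with the smaller of the
  two `𝕋`-onsets).  So the item `BoxMerging` is precisely the non-quantitative half of the crux,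
  and all further content of X sits in the contraction rate (A).

All route notation (`PZ PT Sq seg EZ ET TV Dw`) is inlined verbatim from `GluingContraction`.
References: Langlands–Pouliot–Saint-Aubin, Bull. AMS 30 (1994) §2.3; Schramm–Smirnov, EJP 16
(2011) §1 (Question 2).
-/


noncomputable section

namespace Summit.CriticalPhenomena.CardyFormulaZ2.Theorems

open scoped BigOperators Topology
open Filter Set MeasureTheory
open Literature.Probability.Percolation Literature.Probability.RandomPlanarGeometry
  Literature.Probability.LatticeModels
open Summit.CriticalPhenomena.CardyFormulaZ2.Theses.CardyGluingRDE

/-! ### Monotonicity of `TV_j` in the resolution -/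

/-- **`TV_j ≤ TV_{j+1}`.**  For the route's discrepancy `TV δ₀ j u u'` (half the `ℓ¹` distance
between the bond-`ℤ²` law at mesh `u` and the site-`𝕋` law at mesh `u' > 0` of the resolution-`j`
segment-connectivity matrix of the square `(0, δ₀)²`; `PZ PT Sq seg EZ ET TV` exactly as in
`BoxMerging`): refining the resolution can only increase the discrepancy, because the level-`j`
matrix is read off from the level-`(j+1)` matrix by the same coarse-graining on both lattices.
[folklore] -/
theorem BoxMerging_tv_succ_le :
    let PZ := Literature.Probability.Percolation.bondPercolation
      (Literature.Probability.LatticeModels.zdGraph 2) Literature.Probability.Percolation.half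
    let PT := Literature.Probability.LatticeModels.triSitePercolation
      Literature.Probability.Percolation.half
    let Sq : ℝ → Set ℂ := fun δ₀ => {z : ℂ | 0 < z.re ∧ z.re < δ₀ ∧ 0 < z.im ∧ z.im < δ₀}
    let seg : (δ₀ : ℝ) → (j : ℕ) → Fin 4 × Fin (2 ^ j) → Set ℂ := fun δ₀ j a =>
      {z : ℂ | (a.1 = 0 ∧ z.im = 0 ∧ δ₀ * ((a.2 : ℕ) : ℝ) / 2 ^ j ≤ z.re ∧
          z.re ≤ δ₀ * (((a.2 : ℕ) : ℝ) + 1) / 2 ^ j) ∨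
        (a.1 = 1 ∧ z.re = δ₀ ∧ δ₀ * ((a.2 : ℕ) : ℝ) / 2 ^ j ≤ z.im ∧
          z.im ≤ δ₀ * (((a.2 : ℕ) : ℝ) + 1) / 2 ^ j) ∨
        (a.1 = 2 ∧ z.im = δ₀ ∧ δ₀ * ((a.2 : ℕ) : ℝ) / 2 ^ j ≤ z.re ∧
          z.re ≤ δ₀ * (((a.2 : ℕ) : ℝ) + 1) / 2 ^ j) ∨
        (a.1 = 3 ∧ z.re = 0 ∧ δ₀ * ((a.2 : ℕ) : ℝ) / 2 ^ j ≤ z.im ∧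
          z.im ≤ δ₀ * (((a.2 : ℕ) : ℝ) + 1) / 2 ^ j)}
    let EZ : (δ₀ : ℝ) → (j : ℕ) → ℝ → ((Fin 4 × Fin (2 ^ j)) → (Fin 4 × Fin (2 ^ j)) → Bool) →
        Set (Literature.Probability.Percolation.BondConfig
          (Literature.Probability.LatticeModels.Site 2)) := fun δ₀ j u M =>
      {ω | ∀ a b, ω ∈ Literature.Probability.Percolation.discreteCrossing (Sq δ₀) u (seg δ₀ j a)
        (seg δ₀ j b) ↔ M a b = true}
    let ET : (δ₀ : ℝ) → (j : ℕ) → ℝ → ((Fin 4 × Fin (2 ^ j)) → (Fin 4 × Fin (2 ^ j)) → Bool) →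
        Set (Literature.Probability.Percolation.SiteConfig
          (Literature.Probability.LatticeModels.Site 2)) := fun δ₀ j u M =>
      {ω | ∀ a b, ω ∈ Literature.Probability.LatticeModels.triCrossing (Sq δ₀) u (seg δ₀ j a)
        (seg δ₀ j b) ↔ M a b = true}
    let TV : ℝ → ℕ → ℝ → ℝ → ℝ := fun δ₀ j u u' => (1 / 2 : ℝ) *
      ∑ M : (Fin 4 × Fin (2 ^ j)) → (Fin 4 × Fin (2 ^ j)) → Bool,
        |PZ.real (EZ δ₀ j u M) - PT.real (ET δ₀ j u' M)|
    ∀ δ₀ : ℝ, 0 < δ₀ → ∀ (j : ℕ) (u u' : ℝ), 0 < u' → TV δ₀ j u u' ≤ TV δ₀ (j + 1) u u' := by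
  intro PZ PT Sq seg EZ ET TV δ₀ hδ₀ j u u' hu'
  -- the children of a level-`j` segment and the coarse-graining of a level-`(j+1)` matrix
  set ch : Fin 4 × Fin (2 ^ j) → Finset (Fin 4 × Fin (2 ^ (j + 1))) := fun a =>
    Finset.univ.filter fun a' : Fin 4 × Fin (2 ^ (j + 1)) =>
      a'.1 = a.1 ∧ (a'.2 : ℕ) / 2 = (a.2 : ℕ) with hch
  set cg : ((Fin 4 × Fin (2 ^ (j + 1))) → (Fin 4 × Fin (2 ^ (j + 1))) → Bool) →
      (Fin 4 × Fin (2 ^ j)) → (Fin 4 × Fin (2 ^ j)) → Bool := fun M a b =>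
    decide (∃ a' ∈ ch a, ∃ b' ∈ ch b, M a' b' = true) with hcg
  have hSqR : Sq δ₀ = (rectQuad 0 δ₀ 0 δ₀ hδ₀ hδ₀).carrier := BoxMerging_sq_eq_rectQuad_carrier hδ₀
  have hbdd : Bornology.IsBounded (Sq δ₀) := by
    rw [hSqR]; exact (rectQuad 0 δ₀ 0 δ₀ hδ₀ hδ₀).isBounded
  -- level-`j` crossing events are unions of level-`(j+1)` crossing events
  have hZ : ∀ a b, discreteCrossing (Sq δ₀) u (seg δ₀ j a) (seg δ₀ j b) =
      ⋃ a' ∈ ch a, ⋃ b' ∈ ch b,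
        discreteCrossing (Sq δ₀) u (seg δ₀ (j + 1) a') (seg δ₀ (j + 1) b') :=
    fun a b => BoxMerging_discreteCrossing_succ hδ₀ j u a b
  have hT : ∀ a b, triCrossing (Sq δ₀) u' (seg δ₀ j a) (seg δ₀ j b) =
      ⋃ a' ∈ ch a, ⋃ b' ∈ ch b, triCrossing (Sq δ₀) u' (seg δ₀ (j + 1) a') (seg δ₀ (j + 1) b') :=
    fun a b => BoxMerging_triCrossing_succ hδ₀ j u' a b
  -- so the level-`j` cells are unions of level-`(j+1)` cells over the fibres of `cg`
  have hEZ : ∀ M', EZ δ₀ j u M' =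
      ⋃ M ∈ (Finset.univ.filter fun M => cg M = M'), EZ δ₀ (j + 1) u M := by
    intro M'
    have e : EZ δ₀ j u M' = {ω | ∀ a b, (ω ∈ ⋃ a' ∈ ch a, ⋃ b' ∈ ch b,
        discreteCrossing (Sq δ₀) u (seg δ₀ (j + 1) a') (seg δ₀ (j + 1) b')) ↔ M' a b = true} := by
      ext ω
      show (∀ a b, ω ∈ discreteCrossing (Sq δ₀) u (seg δ₀ j a) (seg δ₀ j b) ↔ M' a b = true) ↔
        ∀ a b, (ω ∈ ⋃ a' ∈ ch a, ⋃ b' ∈ ch b,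
          discreteCrossing (Sq δ₀) u (seg δ₀ (j + 1) a') (seg δ₀ (j + 1) b')) ↔ M' a b = true
      exact forall₂_congr fun a b => by rw [hZ a b]
    rw [e]
    exact BoxMerging_stateEvent_coarsen _ ch M'
  have hET : ∀ M', ET δ₀ j u' M' =
      ⋃ M ∈ (Finset.univ.filter fun M => cg M = M'), ET δ₀ (j + 1) u' M := by
    intro M'
    have e : ET δ₀ j u' M' = {ω | ∀ a b, (ω ∈ ⋃ a' ∈ ch a, ⋃ b' ∈ ch b,
        triCrossing (Sq δ₀) u' (seg δ₀ (j + 1) a') (seg δ₀ (j + 1) b')) ↔ M' a b = true} := by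
      ext ω
      show (∀ a b, ω ∈ triCrossing (Sq δ₀) u' (seg δ₀ j a) (seg δ₀ j b) ↔ M' a b = true) ↔
        ∀ a b, (ω ∈ ⋃ a' ∈ ch a, ⋃ b' ∈ ch b,
          triCrossing (Sq δ₀) u' (seg δ₀ (j + 1) a') (seg δ₀ (j + 1) b')) ↔ M' a b = true
      exact forall₂_congr fun a b => by rw [hT a b]
    rw [e]
    exact BoxMerging_stateEvent_coarsen _ ch M'
  -- total variation contracts under the common coarse-graining
  show (1 / 2 : ℝ) * ∑ M', |PZ.real (EZ δ₀ j u M') - PT.real (ET δ₀ j u' M')| ≤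
    (1 / 2 : ℝ) * ∑ M, |PZ.real (EZ δ₀ (j + 1) u M) - PT.real (ET δ₀ (j + 1) u' M)|
  refine mul_le_mul_of_nonneg_left ?_ (by norm_num)
  calc ∑ M', |PZ.real (EZ δ₀ j u M') - PT.real (ET δ₀ j u' M')|
      = ∑ M', |PZ.real (⋃ M ∈ (Finset.univ.filter fun M => cg M = M'), EZ δ₀ (j + 1) u M) -
          PT.real (⋃ M ∈ (Finset.univ.filter fun M => cg M = M'), ET δ₀ (j + 1) u' M)| := by
        refine Finset.sum_congr rfl fun M' _ => ?_
        rw [hEZ M', hET M']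
    _ ≤ ∑ M, |PZ.real (EZ δ₀ (j + 1) u M) - PT.real (ET δ₀ (j + 1) u' M)| :=
        BoxMerging_sum_abs_fiber_le cg PZ PT
          (BoxMerging_pairwise_disjoint_stateEvent fun a b =>
            discreteCrossing (Sq δ₀) u (seg δ₀ (j + 1) a) (seg δ₀ (j + 1) b))
          (BoxMerging_pairwise_disjoint_stateEvent fun a b =>
            triCrossing (Sq δ₀) u' (seg δ₀ (j + 1) a) (seg δ₀ (j + 1) b))
          (fun M => BoxMerging_measurableSet_stateEvent _ (fun a b =>
            measurableSet_discreteCrossing (Sq δ₀) u (seg δ₀ (j + 1) a) (seg δ₀ (j + 1) b)) M)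
          (fun M => BoxMerging_measurableSet_stateEvent _ (fun a b =>
            BoxMerging_measurableSet_triCrossing hbdd hu' (seg δ₀ (j + 1) a) (seg δ₀ (j + 1) b)) M)

/-- **`TV_j ≤ TV_k` for `j ≤ k`** (every `ℤ²`-mesh `u`, every `𝕋`-mesh `u' > 0`): the route's
discrepancies are monotone along the dyadic hierarchy (`BoxMerging_tv_succ_le`, iterated);
`PZ PT Sq seg EZ ET TV` as in `BoxMerging`. [folklore] -/
theorem BoxMerging_tv_mono :
    let PZ := Literature.Probability.Percolation.bondPercolation
      (Literature.Probability.LatticeModels.zdGraph 2) Literature.Probability.Percolation.half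
    let PT := Literature.Probability.LatticeModels.triSitePercolation
      Literature.Probability.Percolation.half
    let Sq : ℝ → Set ℂ := fun δ₀ => {z : ℂ | 0 < z.re ∧ z.re < δ₀ ∧ 0 < z.im ∧ z.im < δ₀}
    let seg : (δ₀ : ℝ) → (j : ℕ) → Fin 4 × Fin (2 ^ j) → Set ℂ := fun δ₀ j a =>
      {z : ℂ | (a.1 = 0 ∧ z.im = 0 ∧ δ₀ * ((a.2 : ℕ) : ℝ) / 2 ^ j ≤ z.re ∧
          z.re ≤ δ₀ * (((a.2 : ℕ) : ℝ) + 1) / 2 ^ j) ∨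
        (a.1 = 1 ∧ z.re = δ₀ ∧ δ₀ * ((a.2 : ℕ) : ℝ) / 2 ^ j ≤ z.im ∧
          z.im ≤ δ₀ * (((a.2 : ℕ) : ℝ) + 1) / 2 ^ j) ∨
        (a.1 = 2 ∧ z.im = δ₀ ∧ δ₀ * ((a.2 : ℕ) : ℝ) / 2 ^ j ≤ z.re ∧
          z.re ≤ δ₀ * (((a.2 : ℕ) : ℝ) + 1) / 2 ^ j) ∨
        (a.1 = 3 ∧ z.re = 0 ∧ δ₀ * ((a.2 : ℕ) : ℝ) / 2 ^ j ≤ z.im ∧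
          z.im ≤ δ₀ * (((a.2 : ℕ) : ℝ) + 1) / 2 ^ j)}
    let EZ : (δ₀ : ℝ) → (j : ℕ) → ℝ → ((Fin 4 × Fin (2 ^ j)) → (Fin 4 × Fin (2 ^ j)) → Bool) →
        Set (Literature.Probability.Percolation.BondConfig
          (Literature.Probability.LatticeModels.Site 2)) := fun δ₀ j u M =>
      {ω | ∀ a b, ω ∈ Literature.Probability.Percolation.discreteCrossing (Sq δ₀) u (seg δ₀ j a)
        (seg δ₀ j b) ↔ M a b = true}
    let ET : (δ₀ : ℝ) → (j : ℕ) → ℝ → ((Fin 4 × Fin (2 ^ j)) → (Fin 4 × Fin (2 ^ j)) → Bool) →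
        Set (Literature.Probability.Percolation.SiteConfig
          (Literature.Probability.LatticeModels.Site 2)) := fun δ₀ j u M =>
      {ω | ∀ a b, ω ∈ Literature.Probability.LatticeModels.triCrossing (Sq δ₀) u (seg δ₀ j a)
        (seg δ₀ j b) ↔ M a b = true}
    let TV : ℝ → ℕ → ℝ → ℝ → ℝ := fun δ₀ j u u' => (1 / 2 : ℝ) *
      ∑ M : (Fin 4 × Fin (2 ^ j)) → (Fin 4 × Fin (2 ^ j)) → Bool,
        |PZ.real (EZ δ₀ j u M) - PT.real (ET δ₀ j u' M)|
    ∀ δ₀ : ℝ, 0 < δ₀ → ∀ (j k : ℕ), j ≤ k → ∀ (u u' : ℝ), 0 < u' →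
      TV δ₀ j u u' ≤ TV δ₀ k u u' := by
  intro PZ PT Sq seg EZ ET TV δ₀ hδ₀ j k hjk u u' hu'
  induction hjk with
  | refl => exact le_rfl
  | step _ ih => exact ih.trans (BoxMerging_tv_succ_le δ₀ hδ₀ _ u u' hu')

/-- **`BoxMerging` only needs arbitrarily fine resolutions.**  `BoxMerging` is equivalent to:
for every side `δ₀ > 0`, resolution `j` and `ε > 0` there is SOME finer resolution `k ≥ j` at
which the bond-`ℤ²` and site-`𝕋` square laws `ε`-merge for all small meshes — merging at
resolution `k` forces merging at every coarser resolution (`BoxMerging_tv_mono`);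
`PZ PT Sq seg EZ ET TV` as in `BoxMerging`. [folklore] -/
theorem BoxMerging_iff_frequently :
    BoxMerging ↔
    let PZ := Literature.Probability.Percolation.bondPercolation
      (Literature.Probability.LatticeModels.zdGraph 2) Literature.Probability.Percolation.half
    let PT := Literature.Probability.LatticeModels.triSitePercolation
      Literature.Probability.Percolation.half
    let Sq : ℝ → Set ℂ := fun δ₀ => {z : ℂ | 0 < z.re ∧ z.re < δ₀ ∧ 0 < z.im ∧ z.im < δ₀}
    let seg : (δ₀ : ℝ) → (j : ℕ) → Fin 4 × Fin (2 ^ j) → Set ℂ := fun δ₀ j a =>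
      {z : ℂ | (a.1 = 0 ∧ z.im = 0 ∧ δ₀ * ((a.2 : ℕ) : ℝ) / 2 ^ j ≤ z.re ∧
          z.re ≤ δ₀ * (((a.2 : ℕ) : ℝ) + 1) / 2 ^ j) ∨
        (a.1 = 1 ∧ z.re = δ₀ ∧ δ₀ * ((a.2 : ℕ) : ℝ) / 2 ^ j ≤ z.im ∧
          z.im ≤ δ₀ * (((a.2 : ℕ) : ℝ) + 1) / 2 ^ j) ∨
        (a.1 = 2 ∧ z.im = δ₀ ∧ δ₀ * ((a.2 : ℕ) : ℝ) / 2 ^ j ≤ z.re ∧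
          z.re ≤ δ₀ * (((a.2 : ℕ) : ℝ) + 1) / 2 ^ j) ∨
        (a.1 = 3 ∧ z.re = 0 ∧ δ₀ * ((a.2 : ℕ) : ℝ) / 2 ^ j ≤ z.im ∧
          z.im ≤ δ₀ * (((a.2 : ℕ) : ℝ) + 1) / 2 ^ j)}
    let EZ : (δ₀ : ℝ) → (j : ℕ) → ℝ → ((Fin 4 × Fin (2 ^ j)) → (Fin 4 × Fin (2 ^ j)) → Bool) →
        Set (Literature.Probability.Percolation.BondConfig
          (Literature.Probability.LatticeModels.Site 2)) := fun δ₀ j u M =>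
      {ω | ∀ a b, ω ∈ Literature.Probability.Percolation.discreteCrossing (Sq δ₀) u (seg δ₀ j a)
        (seg δ₀ j b) ↔ M a b = true}
    let ET : (δ₀ : ℝ) → (j : ℕ) → ℝ → ((Fin 4 × Fin (2 ^ j)) → (Fin 4 × Fin (2 ^ j)) → Bool) →
        Set (Literature.Probability.Percolation.SiteConfig
          (Literature.Probability.LatticeModels.Site 2)) := fun δ₀ j u M =>
      {ω | ∀ a b, ω ∈ Literature.Probability.LatticeModels.triCrossing (Sq δ₀) u (seg δ₀ j a)
        (seg δ₀ j b) ↔ M a b = true}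
    let TV : ℝ → ℕ → ℝ → ℝ → ℝ := fun δ₀ j u u' => (1 / 2 : ℝ) *
      ∑ M : (Fin 4 × Fin (2 ^ j)) → (Fin 4 × Fin (2 ^ j)) → Bool,
        |PZ.real (EZ δ₀ j u M) - PT.real (ET δ₀ j u' M)|
    ∀ δ₀ : ℝ, 0 < δ₀ → ∀ (j : ℕ) (ε : ℝ), 0 < ε → ∃ k : ℕ, j ≤ k ∧ ∃ η : ℝ, 0 < η ∧
      ∀ u u' : ℝ, 0 < u → u < η → 0 < u' → u' < η → TV δ₀ k u u' ≤ ε := by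
  constructor
  · intro h PZ PT Sq seg EZ ET TV δ₀ hδ₀ j ε hε
    obtain ⟨η, hη, h'⟩ := h δ₀ hδ₀ j ε hε
    exact ⟨j, le_rfl, η, hη, h'⟩
  · intro h
    unfold BoxMerging
    intro PZ PT Sq seg EZ ET TV δ₀ hδ₀ j ε hε
    obtain ⟨k, hjk, η, hη, hk⟩ := h δ₀ hδ₀ j ε hε
    exact ⟨η, hη, fun u u' hu huη hu' hu'η =>
      (BoxMerging_tv_mono δ₀ hδ₀ j k hjk u u' hu').trans (hk u u' hu huη hu' hu'η)⟩

/-! ### The entry clause -/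

/-- **`BoxMerging` gives the entry clause (B) of `GluingContraction`, for all parameters.**
Under `BoxMerging`, for every `σ ≥ 0`, `C > 0`, `ρ > 0`, `m`, `δ₀ > 0` and `K` there are a
`𝕋`-onset `δ_T > 0` and a `ℤ²`-mesh `0 < u_Z ≤ δ₀/(C·2^K)` with `Dw_K(u,u') ≤ ρ/2` for all
`u ∈ [u_Z/2^m, u_Z]`, `0 < u' ≤ δ_T` (`Dw_K ≤ (K+1)·TV_K` by `BoxMerging_tv_mono` and
`2^(−σj) ≤ 1`).  Notation of `GluingContraction`, verbatim. [folklore] -/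
theorem BoxMerging_entry (hBM : BoxMerging) :
    let PZ := Literature.Probability.Percolation.bondPercolation
      (Literature.Probability.LatticeModels.zdGraph 2) Literature.Probability.Percolation.half
    let PT := Literature.Probability.LatticeModels.triSitePercolation
      Literature.Probability.Percolation.half
    let Sq : ℝ → Set ℂ := fun δ₀ => {z : ℂ | 0 < z.re ∧ z.re < δ₀ ∧ 0 < z.im ∧ z.im < δ₀}
    let seg : (δ₀ : ℝ) → (j : ℕ) → Fin 4 × Fin (2 ^ j) → Set ℂ := fun δ₀ j a =>
      {z : ℂ | (a.1 = 0 ∧ z.im = 0 ∧ δ₀ * ((a.2 : ℕ) : ℝ) / 2 ^ j ≤ z.re ∧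
          z.re ≤ δ₀ * (((a.2 : ℕ) : ℝ) + 1) / 2 ^ j) ∨
        (a.1 = 1 ∧ z.re = δ₀ ∧ δ₀ * ((a.2 : ℕ) : ℝ) / 2 ^ j ≤ z.im ∧
          z.im ≤ δ₀ * (((a.2 : ℕ) : ℝ) + 1) / 2 ^ j) ∨
        (a.1 = 2 ∧ z.im = δ₀ ∧ δ₀ * ((a.2 : ℕ) : ℝ) / 2 ^ j ≤ z.re ∧
          z.re ≤ δ₀ * (((a.2 : ℕ) : ℝ) + 1) / 2 ^ j) ∨
        (a.1 = 3 ∧ z.re = 0 ∧ δ₀ * ((a.2 : ℕ) : ℝ) / 2 ^ j ≤ z.im ∧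
          z.im ≤ δ₀ * (((a.2 : ℕ) : ℝ) + 1) / 2 ^ j)}
    let EZ : (δ₀ : ℝ) → (j : ℕ) → ℝ → ((Fin 4 × Fin (2 ^ j)) → (Fin 4 × Fin (2 ^ j)) → Bool) →
        Set (Literature.Probability.Percolation.BondConfig
          (Literature.Probability.LatticeModels.Site 2)) := fun δ₀ j u M =>
      {ω | ∀ a b, ω ∈ Literature.Probability.Percolation.discreteCrossing (Sq δ₀) u (seg δ₀ j a)
        (seg δ₀ j b) ↔ M a b = true}
    let ET : (δ₀ : ℝ) → (j : ℕ) → ℝ → ((Fin 4 × Fin (2 ^ j)) → (Fin 4 × Fin (2 ^ j)) → Bool) →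
        Set (Literature.Probability.Percolation.SiteConfig
          (Literature.Probability.LatticeModels.Site 2)) := fun δ₀ j u M =>
      {ω | ∀ a b, ω ∈ Literature.Probability.LatticeModels.triCrossing (Sq δ₀) u (seg δ₀ j a)
        (seg δ₀ j b) ↔ M a b = true}
    let TV : ℝ → ℕ → ℝ → ℝ → ℝ := fun δ₀ j u u' => (1 / 2 : ℝ) *
      ∑ M : (Fin 4 × Fin (2 ^ j)) → (Fin 4 × Fin (2 ^ j)) → Bool,
        |PZ.real (EZ δ₀ j u M) - PT.real (ET δ₀ j u' M)|
    let Dw : ℝ → ℝ → ℕ → ℝ → ℝ → ℝ := fun σ δ₀ K u u' =>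
      ∑ j ∈ Finset.range (K + 1), (2 : ℝ) ^ (-(σ * (j : ℝ))) * TV δ₀ j u u'
    ∀ σ : ℝ, 0 ≤ σ → ∀ C : ℝ, 0 < C → ∀ ρ : ℝ, 0 < ρ → ∀ (m : ℕ) (δ₀ : ℝ), 0 < δ₀ → ∀ K : ℕ,
      ∃ δT : ℝ, 0 < δT ∧ ∃ uZ : ℝ, 0 < uZ ∧ uZ ≤ δ₀ / (C * 2 ^ K) ∧
        ∀ u u' : ℝ, uZ / 2 ^ m ≤ u → u ≤ uZ → 0 < u' → u' ≤ δT → Dw σ δ₀ K u u' ≤ ρ / 2 := by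
  intro PZ PT Sq seg EZ ET TV Dw σ hσ C hC ρ hρ m δ₀ hδ₀ K
  have hK1 : (0 : ℝ) < (K : ℝ) + 1 := by positivity
  obtain ⟨η, hη, hε⟩ := hBM δ₀ hδ₀ K (ρ / 2 / ((K : ℝ) + 1)) (by positivity)
  refine ⟨η / 2, by positivity, min (η / 2) (δ₀ / (C * 2 ^ K)),
    lt_min (by positivity) (by positivity), min_le_right _ _, ?_⟩
  intro u u' hu1 hu2 hu' hu'T
  have hmin : 0 < min (η / 2) (δ₀ / (C * 2 ^ K)) := lt_min (by positivity) (by positivity)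
  have hu : 0 < u := lt_of_lt_of_le (by positivity) hu1
  have huη : u < η := by
    have h' : u ≤ η / 2 := hu2.trans (min_le_left _ _)
    linarith
  have hu'η : u' < η := by linarith
  -- one application of `BoxMerging` at the top resolution, then monotonicity in `j`
  have hTVK : TV δ₀ K u u' ≤ ρ / 2 / ((K : ℝ) + 1) := hε u u' hu huη hu' hu'η
  have hTVj : ∀ j ∈ Finset.range (K + 1), TV δ₀ j u u' ≤ ρ / 2 / ((K : ℝ) + 1) := fun j hj =>
    (BoxMerging_tv_mono δ₀ hδ₀ j K (Nat.lt_succ_iff.1 (Finset.mem_range.1 hj)) u u' hu').trans hTVK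
  show ∑ j ∈ Finset.range (K + 1), (2 : ℝ) ^ (-(σ * (j : ℝ))) * TV δ₀ j u u' ≤ ρ / 2
  calc ∑ j ∈ Finset.range (K + 1), (2 : ℝ) ^ (-(σ * (j : ℝ))) * TV δ₀ j u u'
      ≤ ∑ j ∈ Finset.range (K + 1), ρ / 2 / ((K : ℝ) + 1) := by
        refine Finset.sum_le_sum fun j hj => ?_
        have h2 : (2 : ℝ) ^ (-(σ * (j : ℝ))) ≤ 1 :=
          Real.rpow_le_one_of_one_le_of_nonpos (by norm_num)
            (neg_nonpos.2 (mul_nonneg hσ (Nat.cast_nonneg j)))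
        have h0 : 0 ≤ TV δ₀ j u u' :=
          mul_nonneg (by norm_num) (Finset.sum_nonneg fun _ _ => abs_nonneg _)
        calc (2 : ℝ) ^ (-(σ * (j : ℝ))) * TV δ₀ j u u' ≤ 1 * TV δ₀ j u u' :=
              mul_le_mul_of_nonneg_right h2 h0
          _ ≤ ρ / 2 / ((K : ℝ) + 1) := by rw [one_mul]; exact hTVj j hj
    _ = ρ / 2 := by
        rw [Finset.sum_const, Finset.card_range, nsmul_eq_mul]
        push_cast
        field_simp

/-- **`GluingContraction ↔ (local contraction alone) ∧ BoxMerging`.**  The thesis X of the route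
is equivalent to its clause (A) (local contraction of `Dw_K` under `m`-fold mesh-halving from the
lattice-resolution onset, with slack `C·2^(−κK)`, for some parameters `σ, θ, C, κ, ρ, m`) together
with the item `BoxMerging`: `→` is `BoxMerging_of_GluingContraction` plus forgetting clause (B);
`←` re-supplies clause (B) for the parameters of (A) by `BoxMerging_entry`, taking the smaller of
the two `𝕋`-onsets.  Notation of `GluingContraction`, verbatim. [folklore] -/
theorem BoxMerging_gluingContraction_iff :
    GluingContraction ↔
      (let PZ := Literature.Probability.Percolation.bondPercolation
        (Literature.Probability.LatticeModels.zdGraph 2) Literature.Probability.Percolation.half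
      let PT := Literature.Probability.LatticeModels.triSitePercolation
        Literature.Probability.Percolation.half
      let Sq : ℝ → Set ℂ := fun δ₀ => {z : ℂ | 0 < z.re ∧ z.re < δ₀ ∧ 0 < z.im ∧ z.im < δ₀}
      let seg : (δ₀ : ℝ) → (j : ℕ) → Fin 4 × Fin (2 ^ j) → Set ℂ := fun δ₀ j a =>
        {z : ℂ | (a.1 = 0 ∧ z.im = 0 ∧ δ₀ * ((a.2 : ℕ) : ℝ) / 2 ^ j ≤ z.re ∧
            z.re ≤ δ₀ * (((a.2 : ℕ) : ℝ) + 1) / 2 ^ j) ∨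
          (a.1 = 1 ∧ z.re = δ₀ ∧ δ₀ * ((a.2 : ℕ) : ℝ) / 2 ^ j ≤ z.im ∧
            z.im ≤ δ₀ * (((a.2 : ℕ) : ℝ) + 1) / 2 ^ j) ∨
          (a.1 = 2 ∧ z.im = δ₀ ∧ δ₀ * ((a.2 : ℕ) : ℝ) / 2 ^ j ≤ z.re ∧
            z.re ≤ δ₀ * (((a.2 : ℕ) : ℝ) + 1) / 2 ^ j) ∨
          (a.1 = 3 ∧ z.re = 0 ∧ δ₀ * ((a.2 : ℕ) : ℝ) / 2 ^ j ≤ z.im ∧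
            z.im ≤ δ₀ * (((a.2 : ℕ) : ℝ) + 1) / 2 ^ j)}
      let EZ : (δ₀ : ℝ) → (j : ℕ) → ℝ → ((Fin 4 × Fin (2 ^ j)) → (Fin 4 × Fin (2 ^ j)) → Bool) →
          Set (Literature.Probability.Percolation.BondConfig
            (Literature.Probability.LatticeModels.Site 2)) := fun δ₀ j u M =>
        {ω | ∀ a b, ω ∈ Literature.Probability.Percolation.discreteCrossing (Sq δ₀) u
          (seg δ₀ j a) (seg δ₀ j b) ↔ M a b = true}
      let ET : (δ₀ : ℝ) → (j : ℕ) → ℝ → ((Fin 4 × Fin (2 ^ j)) → (Fin 4 × Fin (2 ^ j)) → Bool) →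
          Set (Literature.Probability.Percolation.SiteConfig
            (Literature.Probability.LatticeModels.Site 2)) := fun δ₀ j u M =>
        {ω | ∀ a b, ω ∈ Literature.Probability.LatticeModels.triCrossing (Sq δ₀) u (seg δ₀ j a)
          (seg δ₀ j b) ↔ M a b = true}
      let TV : ℝ → ℕ → ℝ → ℝ → ℝ := fun δ₀ j u u' => (1 / 2 : ℝ) *
        ∑ M : (Fin 4 × Fin (2 ^ j)) → (Fin 4 × Fin (2 ^ j)) → Bool,
          |PZ.real (EZ δ₀ j u M) - PT.real (ET δ₀ j u' M)|
      let Dw : ℝ → ℝ → ℕ → ℝ → ℝ → ℝ := fun σ δ₀ K u u' =>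
        ∑ j ∈ Finset.range (K + 1), (2 : ℝ) ^ (-(σ * (j : ℝ))) * TV δ₀ j u u'
      ∃ σ θ C κ ρ : ℝ, ∃ m : ℕ, 0 < σ ∧ 0 ≤ θ ∧ θ < 1 ∧ 0 < C ∧ 0 < κ ∧ 0 < ρ ∧ 1 ≤ m ∧
        ∀ δ₀ : ℝ, 0 < δ₀ → ∀ K : ℕ, ∃ δT : ℝ, 0 < δT ∧
          ∀ u u' : ℝ, 0 < u → u ≤ δ₀ / (C * 2 ^ K) → 0 < u' → u' ≤ δT →
            Dw σ δ₀ K u u' ≤ ρ → Dw σ δ₀ K (u / 2 ^ m) (u' / 2 ^ m) ≤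
              θ * Dw σ δ₀ K u u' + C * (2 : ℝ) ^ (-(κ * (K : ℝ)))) ∧ BoxMerging := by
  constructor
  · intro hX
    refine ⟨?_, BoxMerging_of_GluingContraction hX⟩
    unfold GluingContraction at hX
    intro PZ PT Sq seg EZ ET TV Dw
    obtain ⟨σ, θ, C, κ, ρ, m, hσ, hθ0, hθ1, hC, hκ, hρ, hm, hK⟩ := hX
    refine ⟨σ, θ, C, κ, ρ, m, hσ, hθ0, hθ1, hC, hκ, hρ, hm, fun δ₀ hδ₀ K => ?_⟩
    obtain ⟨δT, hδT, hA, -⟩ := hK δ₀ hδ₀ K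
    exact ⟨δT, hδT, hA⟩
  · rintro ⟨hA, hBM⟩
    unfold GluingContraction
    intro PZ PT Sq seg EZ ET TV Dw
    obtain ⟨σ, θ, C, κ, ρ, m, hσ, hθ0, hθ1, hC, hκ, hρ, hm, hK⟩ := hA
    refine ⟨σ, θ, C, κ, ρ, m, hσ, hθ0, hθ1, hC, hκ, hρ, hm, fun δ₀ hδ₀ K => ?_⟩
    obtain ⟨δT₁, hδT₁, hA₁⟩ := hK δ₀ hδ₀ K
    obtain ⟨δT₂, hδT₂, uZ, huZ, huZle, hB⟩ := BoxMerging_entry hBM σ hσ.le C hC ρ hρ m δ₀ hδ₀ K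
    refine ⟨min δT₁ δT₂, lt_min hδT₁ hδT₂, fun u u' hu hule hu' hu'le hDw =>
      hA₁ u u' hu hule hu' (hu'le.trans (min_le_left _ _)) hDw, uZ, huZ, huZle,
      fun u u' hu1 hu2 hu' hu'le => hB u u' hu1 hu2 hu' (hu'le.trans (min_le_right _ _))⟩

end Summit.CriticalPhenomena.CardyFormulaZ2.Theorems
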